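/-
COR-CM (cell pub-hodgecm2 = stage 2 of the Hodge ladder), seat b28 gen 2 (prover-pub-hodgecm2-b28-g2-0, 2026-08-20),
LIT-FANOUT row D2 (Lefschetz / "complex tori with a Riemann form are projective") at polarisation TYPE D, assembly night:
every complex torus `ℂⁿ/(Dℤⁿ ⊕ Ωℤⁿ)`, `Ω ∈ 𝔥ₙ`, `D = diag(d)`, is analytified by a smooth projective `n`-fold over `ℂ`.
Theorems only: no definition, no named fact, no instance.
-/
import Summits.HodgeConjecture.HodgeConjecture.Theorems.SecondaryPeriodsRiemannWeightOneStubImageAnalytic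
import Summits.HodgeConjecture.HodgeConjecture.Theorems.SecondaryPeriodsRiemannWeightOneStubAlgebraisation
import Summits.HodgeConjecture.HodgeConjecture.Theorems.SecondaryPeriodsRiemannWeightOneStubAlgebraisationSmooth
import Literature.AlgebraicGeometry.Motives.ChowConeChow
import Literature.Geometry.Kaehler.SiegelTorusThetaEmbeddingTypeD
import Literature.NumberTheory.Transcendental.ProjectiveSpaceProofs
import Literature.NumberTheory.Transcendental.ProjectiveSpaceT2Proofs
import Mathlib.LinearAlgebra.Complex.FiniteDimensional
import HarnessLib

/-!
# Complex tori of polarisation type `D` are algebraic: `ℂⁿ/(Dℤⁿ ⊕ Ωℤⁿ)` is analytified by a smooth projective variety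

The geometric input `h₃ = PicardCM.CMAbelianVarietyRealised` of the COR-CM chain (CM abelian varieties
`ℂ^Φ/Φ(𝔞)` exist AS ABELIAN VARIETIES) and Huybrechts' Cor. 5.3.5 ("a complex torus is projective iff
it admits a Riemann form") rest on **Lefschetz's theorem for an arbitrary polarisation type**: the
Riemann form `E(x, y) = Tr_{K/ℚ}(ζ x ȳ)` of a CM torus is in general NOT principal, so the principal
case `D = 1` of the tree (`Geometry.Kaehler.siegelTorus_thetaEmbedding`, consumed by the crux
`RiemannWeightOne` of route `SecondaryPeriods`) does not suffice. In a symplectic basis of the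
lattice for a Riemann form of type `D = diag(d₁, …, dₙ)` the torus is `ℂⁿ/(Dℤⁿ ⊕ Ωℤⁿ)` with `Ω` in
the Siegel upper half space (Lange–Birkenhake §3.1, §8.1: period matrix `(Z, D)`; Thm. 4.2.1, the
Riemann relations). This file proves, for every such `(Ω, D)`:

* `exists_smoothProjective_of_projectiveEmbedding` — the ALGEBRAISATION PACKAGE of the tree, stated
  once for all consumers: a compact connected complex manifold `M` (model `ℂⁿ`) with an injective
  holomorphic immersion `F : M → ℙᴺ(ℂ)` is analytified by a reduced closed subscheme `X ⊆ ℙᴺ_ℂ`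
  which is smooth projective of dimension `n`, compatibly with `F` — the kernel theorems
  `RiemannWeightOne.stub_imageAnalytic` (the image is a closed analytic subset), Chow's theorem
  `Motives.isProjAlgebraicSet_of_isAnalyticSet_holds`, `RiemannWeightOne.stub_algebraisation` (the
  reduced induced subscheme and its analytification) and `RiemannWeightOne.stub_algebraisationSmooth`
  (Serre, GAGA §2 n°6), exactly as composed inside
  `Theorems.weightOne_polarizable_eq_range_of_smoothProjective_holds`;
* `exists_siegelPeriodIso_typeD` — for `Ω ∈ 𝔥ₙ` and `dᵢ ≥ 1` the real-linear map
  `(x, y) ↦ Dx + Ωy : ℝⁿ ⊕ ℝⁿ → ℂⁿ` is an isomorphism (its kernel is trivial because `Im Ω` is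
  positive definite), i.e. a period isomorphism `Φ` of the tree's `ComplexTorus Φ` with lattice
  `Dℤⁿ ⊕ Ωℤⁿ` EXISTS;
* `exists_smoothProjective_of_siegel_typeD` — **the theorem**: for every period isomorphism `Φ` of
  lattice `Dℤⁿ ⊕ Ωℤⁿ` there are `N`, a reduced closed subscheme `X ⊆ ℙᴺ_ℂ`, smooth projective of
  dimension `n`, and an analytification `φ : ComplexTorus Φ → X(ℂ)` (by the theta embedding of type
  `D`, `Geometry.Kaehler.siegelTorus_thetaEmbedding_typeD`); `exists_smoothProjective_torus_typeD`
  combines the two.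

Neighbouring tree results (all by name, none restated here): (i) the integer symplectic normal
form — Frobenius' elementary divisor theorem `LinearAlgebra.FreeModule.exists_frobeniusBasis`
(`AlternatingElementaryDivisors.lean`) and the Siegel normalisation / biholomorphic transport
`Geometry.Kaehler.ComplexTorus.exists_siegelTorus_typeD` (`ComplexTorusSiegelNormalForm.lean`), which
put an arbitrary `ComplexTorus Φ` with a Riemann form in the form `(D, Ω)` consumed below; (ii) the
ALGEBRAIC GROUP LAW on `X` (GAGA for maps `Transcendental.arapura2012_cor_15_4_6_holds`,
Lange–Birkenhake Thm. 2.1.13 / Cor. 2.1.17), i.e. the `Motives.AbelianVariety ℂ` structure — not in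
this file.

## References

* [LangeBirkenhake1992] H. Lange, Ch. Birkenhake, Complex Abelian Varieties (1992), §3.1, Thm. 4.2.1,
  Thm. 4.5.1 (Lefschetz), §8.1, Thm. 2.1.18, App. A (Chow).
* [MumfordAV1970] D. Mumford, Abelian Varieties (1970), §3 (Theorem of Lefschetz).
* [SerreGAGA1956] J.-P. Serre, Géométrie algébrique et géométrie analytique (1956), §2 n°5–6, §3 Prop. 13.
* [HuybrechtsComplexGeometry2005] D. Huybrechts, Complex Geometry (2005), Cor. 5.3.5.
* [Shimura1998] G. Shimura, Abelian Varieties with Complex Multiplication and Modular Functions (1998),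
  §6.2 Thm. 3, Thm. 4.
-/

noncomputable section

namespace Summit.HodgeConjecture.CorCM

open scoped Manifold ContDiff LinearAlgebra.Projectivization
open CategoryTheory AlgebraicGeometry
open Literature.AlgebraicGeometry.Motives
open Literature.Geometry.Kaehler (ComplexTorus IsAnalyticSet)
open Literature.NumberTheory.Transcendental (IsAnalytification IsProjAlgebraicSet projPoint)
open Summit.HodgeConjecture.HodgeConjecture.Theorems

/-! ### The algebraisation package: embedded compact complex manifolds are smooth projective varieties -/

/-- **Algebraisation of an embedded compact complex manifold** (Chow + Serre GAGA, as composed in the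
tree's proof of Riemann's theorem `Theorems.weightOne_polarizable_eq_range_of_smoothProjective_holds`):
a compact connected complex manifold `M` (model `ℂⁿ`) with an injective holomorphic immersion
`F : M → ℙᴺ(ℂ)` is analytified — through `F` — by a reduced closed subscheme `X ⊆ ℙᴺ_ℂ` which is a
smooth projective variety of dimension `n`: the image is a closed analytic subset
(`RiemannWeightOne.stub_imageAnalytic`), hence projective algebraic (Chow,
`Motives.isProjAlgebraicSet_of_isAnalyticSet_holds`); the reduced induced closed subscheme on it is
analytified by `M` (`RiemannWeightOne.stub_algebraisation`) and is smooth projective of dimension `n`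
(`RiemannWeightOne.stub_algebraisationSmooth`). [cite: SerreGAGA1956, §2 n°5–6 and §3 Prop. 13]
[cite: LangeBirkenhake1992, App. A (Chow's theorem)] -/
theorem exists_smoothProjective_of_projectiveEmbedding {n N : ℕ} {M : Type} [TopologicalSpace M]
    [T2Space M] [CompactSpace M] [ConnectedSpace M] [ChartedSpace (Fin n → ℂ) M]
    [IsManifold 𝓘(ℂ, Fin n → ℂ) ω M] (F : M → ℙ ℂ (Fin (N + 1) → ℂ))
    (hF : ContMDiff 𝓘(ℂ, Fin n → ℂ) 𝓘(ℂ, Fin N → ℂ) ω F) (hFinj : Function.Injective F)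
    (hFimm : ∀ x, Function.Injective (mfderiv 𝓘(ℂ, Fin n → ℂ) 𝓘(ℂ, Fin N → ℂ) F x)) :
    ∃ (X : SchemeOver ℂ) (ι : X ⟶ projectiveSpace N ℂ) (_ : IsClosedImmersion ι.left)
      (_ : IsReduced X.left) (φ : M → ComplexPoints X),
      IsAnalytification (Fin n → ℂ) X n φ ∧ (∀ m, AlgPoints.map ι (φ m) = projPoint N (F m)) ∧
        IsSmoothProjective n X := by
  haveI : IsManifold 𝓘(ℂ, Fin N → ℂ) ω (ℙ ℂ (Fin (N + 1) → ℂ)) :=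
    Literature.NumberTheory.Transcendental.isManifold_projectivization_holds ℂ N
  haveI : T2Space (ℙ ℂ (Fin (N + 1) → ℂ)) :=
    Literature.NumberTheory.Transcendental.t2Space_projectivization_holds ℂ N
  -- the image is a closed analytic subset, hence projective algebraic (Chow)
  have hAn : IsAnalyticSet 𝓘(ℂ, Fin N → ℂ) (Set.range F) :=
    RiemannWeightOne.stub_imageAnalytic F hF hFinj hFimm
  have hcl : IsClosed (Set.range F) := (isCompact_range hF.continuous).isClosed
  have hAlg : IsProjAlgebraicSet (Set.range F) :=
    isProjAlgebraicSet_of_isAnalyticSet_holds (n := N) hcl hAn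
  -- algebraise: reduced closed subscheme `X ⊆ ℙᴺ`, analytified by `M`, smooth projective
  obtain ⟨X, ιX, hιX, hXred, φ₀, hφ₀, hcomp⟩ := RiemannWeightOne.stub_algebraisation F hF hFinj hAlg
  haveI := hιX
  haveI := hXred
  have hX : IsSmoothProjective n X :=
    RiemannWeightOne.stub_algebraisationSmooth F hF hFinj hFimm ιX φ₀ hφ₀ hcomp
  exact ⟨X, ιX, hιX, hXred, φ₀, hφ₀, hcomp, hX⟩

/-! ### The period isomorphism `(x, y) ↦ Dx + Ωy` -/

/-- **The period isomorphism of type `(D, Ω)` exists**: for `Ω` symmetric with positive definite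
imaginary part and positive integers `dᵢ`, the real-linear map `(x, y) ↦ Dx + Ωy : ℝⁿ ⊕ ℝⁿ → ℂⁿ` is
a (continuous) linear isomorphism — its kernel is trivial since `Dx + Ωy = 0` forces `(Im Ω) y = 0`,
so `y = 0` (`Im Ω ≻ 0`) and then `Dx = 0`; the dimensions agree. Hence the lattice `Dℤⁿ ⊕ Ωℤⁿ` is a
full lattice and `ℂⁿ/(Dℤⁿ ⊕ Ωℤⁿ)` is one of the tree's complex tori `ComplexTorus Φ`.
[cite: LangeBirkenhake1992, §8.1 (period matrices `(Z, D)`)] -/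
theorem exists_siegelPeriodIso_typeD {n : ℕ} (Ω : Matrix (Fin n) (Fin n) ℂ)
    (hpos : (Matrix.of fun i j => (Ω i j).im).PosDef) (d : Fin n → ℕ) (hd : ∀ i, 0 < d i) :
    ∃ Φ : (Fin n ⊕ Fin n → ℝ) ≃L[ℝ] (Fin n → ℂ),
      ∀ v i, Φ v i = (d i : ℂ) * (v (Sum.inl i) : ℂ) + ∑ j, Ω i j * (v (Sum.inr j) : ℂ) := by
  -- the linear map
  let L : (Fin n ⊕ Fin n → ℝ) →ₗ[ℝ] (Fin n → ℂ) :=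
    { toFun := fun v i => (d i : ℂ) * (v (Sum.inl i) : ℂ) + ∑ j, Ω i j * (v (Sum.inr j) : ℂ)
      map_add' := fun v w => by
        funext i
        simp only [Pi.add_apply, Complex.ofReal_add, mul_add, Finset.sum_add_distrib]
        ring
      map_smul' := fun c v => by
        funext i
        simp only [Pi.smul_apply, smul_eq_mul, Complex.ofReal_mul, RingHom.id_apply,
          Complex.real_smul, mul_add, Finset.mul_sum]
        refine congrArg₂ (· + ·) (by ring) (Finset.sum_congr rfl fun j _ => by ring) }
  have hL : ∀ v i, L v i = (d i : ℂ) * (v (Sum.inl i) : ℂ) + ∑ j, Ω i j * (v (Sum.inr j) : ℂ) :=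
    fun v i => rfl
  -- injectivity: `Dx + Ωy = 0 ⟹ (Im Ω) y = 0 ⟹ y = 0 ⟹ x = 0`
  obtain ⟨c, hc, hY⟩ := Literature.Analysis.SpecialFunctions.exists_pos_mul_sum_sq_le_of_posDef_im Ω hpos
  have hinj : Function.Injective L := by
    refine (injective_iff_map_eq_zero L).mpr fun v hv => ?_
    set x : Fin n → ℝ := fun i => v (Sum.inl i) with hx
    set y : Fin n → ℝ := fun j => v (Sum.inr j) with hy
    have hcoord : ∀ i, (d i : ℂ) * (x i : ℂ) + ∑ j, Ω i j * (y j : ℂ) = 0 := fun i => by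
      have := congrFun hv i
      rwa [hL] at this
    -- imaginary parts: `Σⱼ (Im Ω)ᵢⱼ yⱼ = 0`
    have him : ∀ i, ∑ j, (Ω i j).im * y j = 0 := by
      intro i
      have h := congrArg Complex.im (hcoord i)
      simp only [Complex.add_im, Complex.mul_im, Complex.natCast_re, Complex.natCast_im,
        Complex.ofReal_re, Complex.ofReal_im, mul_zero, zero_mul, add_zero, Complex.im_sum,
        Complex.zero_im, zero_add] at h
      simpa [mul_comm] using h
    have hy0 : y = 0 := by
      have hq : ∑ i, ∑ j, y i * (Ω i j).im * y j = 0 := by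
        refine Finset.sum_eq_zero fun i _ => ?_
        have : ∑ j, y i * (Ω i j).im * y j = y i * ∑ j, (Ω i j).im * y j := by
          rw [Finset.mul_sum]
          exact Finset.sum_congr rfl fun j _ => by ring
        rw [this, him i, mul_zero]
      have hle := hY y
      rw [hq] at hle
      have hsq : ∑ i, y i ^ 2 = 0 := by
        have h0 : 0 ≤ ∑ i, y i ^ 2 := Finset.sum_nonneg fun i _ => sq_nonneg (y i)
        nlinarith
      funext i
      have := (Finset.sum_eq_zero_iff_of_nonneg fun j _ => sq_nonneg (y j)).mp hsq i (Finset.mem_univ i)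
      exact pow_eq_zero_iff two_ne_zero |>.mp this
    -- real parts: `dᵢ xᵢ = 0`
    have hx0 : x = 0 := by
      funext i
      have h := hcoord i
      have hyj : ∀ j, (y j : ℂ) = 0 := fun j => by rw [hy0]; simp
      simp only [hyj, mul_zero, Finset.sum_const_zero, add_zero, mul_eq_zero, Nat.cast_eq_zero,
        Complex.ofReal_eq_zero] at h
      exact h.resolve_left (hd i).ne'
    funext k
    rcases k with i | j
    · exact congrFun hx0 i
    · exact congrFun hy0 j
  -- dimensions: `2n = 2n`
  have hdim : Module.finrank ℝ (Fin n ⊕ Fin n → ℝ) = Module.finrank ℝ (Fin n → ℂ) := by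
    rw [Module.finrank_fintype_fun_eq_card, Module.finrank_pi_fintype]
    simp only [Complex.finrank_real_complex, Finset.sum_const, Finset.card_univ, Fintype.card_fin,
      smul_eq_mul, Fintype.card_sum]
    ring
  refine ⟨(L.linearEquivOfInjective hinj hdim).toContinuousLinearEquiv, fun v i => ?_⟩
  exact congrFun (LinearMap.linearEquivOfInjective_apply hinj hdim v) i ▸ hL v i

/-! ### The torus `ℂⁿ/(Dℤⁿ ⊕ Ωℤⁿ)` is a smooth projective variety -/

/-- **Complex tori of polarisation type `D` are smooth projective varieties** (Lefschetz + Chow +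
GAGA). For `Ω` symmetric with positive definite imaginary part, positive integers `d₁, …, dₙ` and a
period isomorphism `Φ : ℝⁿ ⊕ ℝⁿ ≃ ℂⁿ`, `(x, y) ↦ Dx + Ωy` (so `ComplexTorus Φ = ℂⁿ/(Dℤⁿ ⊕ Ωℤⁿ)`),
there are `N`, a reduced closed subscheme `X ⊆ ℙᴺ_ℂ` which is SMOOTH PROJECTIVE of dimension `n`, an
analytification `φ : ComplexTorus Φ → X(ℂ)`, and the theta embedding `F` of type `D` through which
it factors. Lefschetz: Lange–Birkenhake Thm. 4.5.1 (`L³` very ample for every positive `L`), here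
`Geometry.Kaehler.siegelTorus_thetaEmbedding_typeD`; algebraisation:
`exists_smoothProjective_of_projectiveEmbedding`. [cite: LangeBirkenhake1992, Thm. 4.5.1 and App. A]
[cite: MumfordAV1970, §3 (Theorem of Lefschetz)] [cite: SerreGAGA1956, §2 n°5–6] -/
theorem exists_smoothProjective_of_siegel_typeD {n : ℕ} (Ω : Matrix (Fin n) (Fin n) ℂ)
    (hΩ : ∀ i j, Ω i j = Ω j i) (hpos : (Matrix.of fun i j => (Ω i j).im).PosDef)
    (d : Fin n → ℕ) (hd : ∀ i, 0 < d i) (Φ : (Fin n ⊕ Fin n → ℝ) ≃L[ℝ] (Fin n → ℂ))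
    (hΦ : ∀ v i, Φ v i = (d i : ℂ) * (v (Sum.inl i) : ℂ) + ∑ j, Ω i j * (v (Sum.inr j) : ℂ)) :
    ∃ (N : ℕ) (F : ComplexTorus Φ → ℙ ℂ (Fin (N + 1) → ℂ)) (X : SchemeOver ℂ)
      (ι : X ⟶ projectiveSpace N ℂ) (_ : IsClosedImmersion ι.left) (_ : IsReduced X.left)
      (φ : ComplexTorus Φ → ComplexPoints X),
      ContMDiff 𝓘(ℂ, Fin n → ℂ) 𝓘(ℂ, Fin N → ℂ) ω F ∧ Function.Injective F ∧
      IsAnalytification (Fin n → ℂ) X n φ ∧ (∀ m, AlgPoints.map ι (φ m) = projPoint N (F m)) ∧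
        IsSmoothProjective n X := by
  obtain ⟨N, F, hF, hFinj, hFimm⟩ :=
    Literature.Geometry.Kaehler.siegelTorus_thetaEmbedding_typeD Ω hΩ hpos d hd Φ hΦ
  obtain ⟨X, ι, hι, hred, φ, hφ, hcomp, hX⟩ :=
    exists_smoothProjective_of_projectiveEmbedding F hF hFinj hFimm
  exact ⟨N, F, X, ι, hι, hred, φ, hF, hFinj, hφ, hcomp, hX⟩

/-- **Every pair `(Ω, D)` — `Ω` in the Siegel upper half space, `D = diag(d)` with `dᵢ ≥ 1` — defines
a complex torus `ℂⁿ/(Dℤⁿ ⊕ Ωℤⁿ)` which is analytified by a smooth projective `n`-fold over `ℂ`**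
(`exists_siegelPeriodIso_typeD` + `exists_smoothProjective_of_siegel_typeD`). With the symplectic
normal form of a Riemann form this is "complex tori with a Riemann form are projective"
(Huybrechts Cor. 5.3.5 ⇐; Lange–Birkenhake Thm. 4.5.1) for every polarisation type.
[cite: LangeBirkenhake1992, Thm. 4.5.1 and §8.1] [cite: HuybrechtsComplexGeometry2005, Corollary 5.3.5] -/
theorem exists_smoothProjective_torus_typeD {n : ℕ} (Ω : Matrix (Fin n) (Fin n) ℂ)
    (hΩ : ∀ i j, Ω i j = Ω j i) (hpos : (Matrix.of fun i j => (Ω i j).im).PosDef)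
    (d : Fin n → ℕ) (hd : ∀ i, 0 < d i) :
    ∃ (Φ : (Fin n ⊕ Fin n → ℝ) ≃L[ℝ] (Fin n → ℂ)),
      (∀ v i, Φ v i = (d i : ℂ) * (v (Sum.inl i) : ℂ) + ∑ j, Ω i j * (v (Sum.inr j) : ℂ)) ∧
      ∃ (N : ℕ) (X : SchemeOver ℂ) (ι : X ⟶ projectiveSpace N ℂ) (_ : IsClosedImmersion ι.left)
        (_ : IsReduced X.left) (φ : ComplexTorus Φ → ComplexPoints X),
        IsAnalytification (Fin n → ℂ) X n φ ∧ IsSmoothProjective n X := by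
  obtain ⟨Φ, hΦ⟩ := exists_siegelPeriodIso_typeD Ω hpos d hd
  obtain ⟨N, F, X, ι, hι, hred, φ, -, -, hφ, -, hX⟩ :=
    exists_smoothProjective_of_siegel_typeD Ω hΩ hpos d hd Φ hΦ
  exact ⟨Φ, hΦ, N, X, ι, hι, hred, φ, hφ, hX⟩

end Summit.HodgeConjecture.CorCM

end
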